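import Summits.QuantumFields.YangMills.Theorems.BalabanUVNodesN07CentralDescendantLifts
import Literature.MathematicalPhysics.QuantumFieldTheory.Balaban1983to89.BlockAveragingPlaquetteBound
import HarnessLib

/-!
# BalabanUVNodes ∕ N07 — THE ONE-STEP CENTRAL RESPONSE IN THE PRIVATE COORDINATE `β(c)`: the matrix calculus of the one-variable normal form `Φ(W) = eml(i ↦ central ? 1 : h_i·W*)·W`
# of the (0.4) average (`BlockAveragingEMLHaarAC`), its `(1 − m∕|I|)·X + O(157α)·X` response estimate from [B7AVG] (0.8), and the identification of file 3's `fderiv (avgM · c)` response with `DΦ`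

Cell `pub-ymgap`, width seat `pub-ymgap-dag-n07-w2` generation 2 (HUMAN RULING D-0149; DAG node N07 = [15] = [Balaban1985Variational]; W-SEAT START LIST §n07 S2, file 4a of the w2 lane's successor
pieces; companion 4b `…N07CentralResponseOnto` concludes ONTO and feeds file 3).  `--kind proof --supports stmt-QuantumFields-20542 --as helper` (K1⁷; count-neutral; theorems only).  CONSUMED BY
NAME, nothing modified: the tree's `BlockAveragingEMLHaarAC` (ONE-VARIABLE NORMAL FORM of (0.4) in the private coordinate: `avgFun_update_centralBond_self`, `fibreMap_of_mem`, `fibreFamily_of_isCentral`,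
`coe_fibreFamily_of_not_isCentral`, `small_update_centralBond_self_iff`, `coe_avg_expMeanLogSU`, `loopHol_update_centralBond_self`), `BlockAveragingHaarAC` (`centralBond`, `pre`, `post`, `openHol`,
`IsCentral`), [B7AVG] (0.8) calculus `BlockAveragingEMLAnalyticMean.norm_fderiv_eml_sub_mean_le` (`D eml = mean + O(‖U − 1‖)`), `ExpMeanLog.differentiableAt_eml`, `BlockAveragingPlaquetteBound.norm_eml_sub_one_le_six_mul`,
35a (`expChart`, `hasDerivAt_coe_expChart_along`, `hasDerivAt_ray`), file 1 (`eventually_small_comp_of_small_of_local`), file 3 (`hasDerivAt_coe_avgFun_comp_apply_of_small_of_local`).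

WHY.  File 3 reduced the per-level LIFTS of (45) to ONE analytic statement per guarded coarse bond `c` (`hresp`): the derivative of `W ↦ avgM W c` at `↑Ū^i U` in the direction supported at the
central bond `β(c)` maps the tangent space at `Ū^i U(β c)` ONTO the tangent space at `Ū^{i+1} U(c)`.  In the private coordinate the (0.4) average IS the explicit one-variable map
`Φ(W) = exp[|I|⁻¹ Σ_{i off-central} log(h_i W*)]·W` (central loops are degenerate; `h_i` = the open holonomies; `W = pre·g·post`), so the response is `DΦ(W₀)[X·W₀]·W₀* = D eml(F₀)[−h_iW₀*X] + eml(F₀)·X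
= (1 − m∕|I|)·X + O(α)·X` (`m` off-central indices; (0.8): `D eml = mean + O(α)`, `eml = 1 + O(α)`).  THIS FILE: §1 the calculus of `Φ` (derivative along a curve; the `157α` estimate, SU(N), any index
set); §2 the normal form in matrices for `SU(N)` (the `SU(2)` edition is the route `UnitScaleTilt`'s `Prop8Criticality.coe_avgFun_update_centralBond`; the response estimate there is
`Prop7FibreVelocity.norm_deriv_centralBond_sub_le` ∕ `offCentral_ratio_eq` in `PlaqSmall` currency) and ★★ the identity «file 3's `fderiv (avgM · c)` response at `U(β)·Y·δ_β` = `DΦ(W₀)[pre·U(β)·Y·post]`»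
(both are the velocity of `t ↦ ↑Ū(U·exp(t·Yδ_β))(c)`).

HONEST FRAMING: kernel calculus about the tree's own averaging map; no definition; nothing of [15] Sects. B–F asserted; stub 1 ∕ K0⁷ NOT closed; N07 NOT discharged; counts unmoved (5∕27); one
finite T⁴ programme at fixed ε — NOT continuum ∕ ℝ⁴ ∕ OS ∕ mass gap ∕ Clay (R4 closes the conditional rung `BalabanLadder.UV` only).  No `sorry`, no `instance`, no `notation`.
-/

noncomputable section

open scoped Matrix.Norms.L2Operator Topology
open Filter

namespace Summit.QuantumFields.YangMills.BalabanUVNodes.N07CentralResponseNormalForm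

open Literature.MathematicalPhysics.QuantumFieldTheory.Balaban1983to89
open Literature.MathematicalPhysics.QuantumFieldTheory.Balaban1983to89.T4Continuum (T4Family)
open Literature.MathematicalPhysics.QuantumFieldTheory.Balaban1983to89.B15DeterminingSets
open Literature.MathematicalPhysics.QuantumFieldTheory.Balaban1983to89.T4AdjointCovarianceUnitary (lieSU expSU coe_expSU)
open Literature.MathematicalPhysics.QuantumFieldTheory.Balaban1983to89.BlockAveraging (Small Idx avgFun loopHol)
open Literature.MathematicalPhysics.QuantumFieldTheory.Balaban1983to89.BlockAveragingHaarAC (centralBond pre post openHol IsCentral)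
open Literature.MathematicalPhysics.QuantumFieldTheory.Balaban1983to89.BlockAveragingEMLHaarAC
  (fibreFamily fibreFamily_of_isCentral coe_fibreFamily_of_not_isCentral avgFun_update_centralBond_self fibreMap_of_mem small_update_centralBond_self_iff
   coe_avg_expMeanLogSU offCard offCard_lt_card emlWeight)
open Literature.MathematicalPhysics.QuantumFieldTheory.Balaban1983to89.ExpMeanLog (eml eml_eq_exp expMeanLogSU deltaSU differentiableAt_eml)
open Literature.MathematicalPhysics.QuantumFieldTheory.Balaban1983to89.B7TransferAnalyticMean (meanCLM meanCLM_apply)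
open Literature.MathematicalPhysics.QuantumFieldTheory.Balaban1983to89.BlockAveragingEMLAnalyticMean (norm_fderiv_eml_sub_mean_le)
open Literature.MathematicalPhysics.QuantumFieldTheory.Balaban1983to89.BlockAveragingPlaquetteBound (norm_eml_sub_one_le_six_mul)
open Literature.MathematicalPhysics.QuantumFieldTheory.Balaban1983to89.Node00
open Summit.QuantumFields.YangMills.BalabanUVNodes.N07CritTangentConverse (star_mul_deriv_mem_lieSU)

/-! ## §1  Matrix calculus of the one-variable normal form `Φ(W) = eml(i ↦ central ? 1 : h_i·W*)·W` -/

section NormalForm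

variable {ι : Type*} [Fintype ι] {N : ℕ}

/-- **THE DERIVATIVE OF THE NORMAL FORM ALONG A CURVE**: for a matrix curve `W` with `W′(0) = V` and the off-central family `h_i·W(0)*` in the polydisc `‖· − 1‖ < 1`,
`d∕dt [eml(i ↦ central ? 1 : h_i·W(t)*)·W(t)]∣₀ = D eml(F₀)[i ↦ central ? 0 : h_i·V*]·W(0) + eml(F₀)·V` (chain rule through the analytic `eml`, product rule).
[cite: Balaban1987RG1, (0.4), (0.8) p.253] -/
theorem hasDerivAt_eml_normalForm (cen : ι → Prop) [DecidablePred cen] (h : ι → Matrix (Fin N) (Fin N) ℂ)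
    {W : ℝ → Matrix (Fin N) (Fin N) ℂ} {V : Matrix (Fin N) (Fin N) ℂ} (hW : HasDerivAt W V 0)
    (hpoly : ∀ i, ‖(if cen i then (1 : Matrix (Fin N) (Fin N) ℂ) else h i * star (W 0)) - 1‖ < 1) :
    HasDerivAt (fun t : ℝ => eml (fun i => if cen i then (1 : Matrix (Fin N) (Fin N) ℂ) else h i * star (W t)) * W t)
      (fderiv ℂ (eml : (ι → Matrix (Fin N) (Fin N) ℂ) → Matrix (Fin N) (Fin N) ℂ) (fun i => if cen i then 1 else h i * star (W 0))
          (fun i => if cen i then 0 else h i * star V) * W 0 +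
        eml (fun i => if cen i then (1 : Matrix (Fin N) (Fin N) ℂ) else h i * star (W 0)) * V) 0 := by
  have hF : HasDerivAt (fun t : ℝ => fun i => if cen i then (1 : Matrix (Fin N) (Fin N) ℂ) else h i * star (W t))
      (fun i => if cen i then (0 : Matrix (Fin N) (Fin N) ℂ) else h i * star V) 0 := by
    refine hasDerivAt_pi.2 fun i => ?_
    by_cases hc : cen i
    · simp only [hc, if_true]
      exact hasDerivAt_const _ _
    · simp only [hc, if_false]
      exact hW.star.const_mul (h i)
  have heml : HasFDerivAt (eml : (ι → Matrix (Fin N) (Fin N) ℂ) → Matrix (Fin N) (Fin N) ℂ)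
      ((fderiv ℂ (eml : (ι → Matrix (Fin N) (Fin N) ℂ) → Matrix (Fin N) (Fin N) ℂ)
        (fun i => if cen i then 1 else h i * star (W 0))).restrictScalars ℝ)
      ((fun t : ℝ => fun i => if cen i then (1 : Matrix (Fin N) (Fin N) ℂ) else h i * star (W t)) 0) :=
    ((differentiableAt_eml hpoly).hasFDerivAt).restrictScalars ℝ
  have hcomp := heml.comp_hasDerivAt (0 : ℝ) hF
  have hprod := hcomp.mul hW
  simp only [Function.comp_def, ContinuousLinearMap.coe_restrictScalars'] at hprod
  exact hprod

/-- **THE CENTRAL RESPONSE IS `(1 − m∕|I|)·X + O(α)·X`**: with the off-central family `‖h_i·W₀* − 1‖ ≤ α ≤ 1∕24` (`m` off-central indices), `W₀W₀* = 1` and `X* = −X`,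
`‖(D eml(F₀)[i ↦ central ? 0 : h_i(XW₀)*]·W₀ + eml(F₀)·XW₀)·W₀* − X + (m∕|I|)·X‖ ≤ 157·α·‖X‖` ([B7AVG] (0.8): `‖D eml(F₀) − mean‖ ≤ 144‖F₀ − 1‖`, `‖eml F₀ − 1‖ ≤ 6α`, and the mean of
`i ↦ central ? 0 : −h_iW₀*X` is `−(m∕|I|)X` up to `α‖X‖`). [cite: Balaban1987RG1, (0.8) p.253; Balaban1985Averaging, Prop. 3 (124) p.36] -/
theorem norm_centralResponse_sub_le [Nonempty ι] (cen : ι → Prop) [DecidablePred cen] (h : ι → Matrix (Fin N) (Fin N) ℂ) [NeZero N]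
    (W₀ X : Matrix (Fin N) (Fin N) ℂ) {α : ℝ} (hα0 : 0 ≤ α) (hα : α ≤ 1 / 24)
    (hh : ∀ i, ¬ cen i → ‖h i * star W₀ - 1‖ ≤ α) (hW₀ : W₀ * star W₀ = 1) (hX : star X = -X) :
    ‖(fderiv ℂ (eml : (ι → Matrix (Fin N) (Fin N) ℂ) → Matrix (Fin N) (Fin N) ℂ) (fun i => if cen i then 1 else h i * star W₀)
          (fun i => if cen i then 0 else h i * star (X * W₀)) * W₀ +
        eml (fun i => if cen i then (1 : Matrix (Fin N) (Fin N) ℂ) else h i * star W₀) * (X * W₀)) * star W₀ - X +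
        (((Finset.univ.filter fun i => ¬ cen i).card : ℂ) / (Fintype.card ι : ℂ)) • X‖ ≤ 157 * α * ‖X‖ := by
  haveI : Nonempty (Fin N) := ⟨⟨0, Nat.pos_of_ne_zero (NeZero.ne N)⟩⟩
  set F₀ : ι → Matrix (Fin N) (Fin N) ℂ := fun i => if cen i then 1 else h i * star W₀ with hF₀
  set H : ι → Matrix (Fin N) (Fin N) ℂ := fun i => if cen i then 0 else h i * star (X * W₀) with hH
  set D : Matrix (Fin N) (Fin N) ℂ := fderiv ℂ (eml : (ι → Matrix (Fin N) (Fin N) ℂ) → Matrix (Fin N) (Fin N) ℂ) F₀ H with hD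
  set m : ℕ := (Finset.univ.filter fun i => ¬ cen i).card with hm
  set cI : ℂ := (Fintype.card ι : ℂ) with hcI
  have hcard : 0 < Fintype.card ι := Fintype.card_pos
  have hcI0 : cI ≠ 0 := by rw [hcI]; exact_mod_cast hcard.ne'
  -- the off-central family and the direction
  have hHi : ∀ i, H i = if cen i then 0 else -((h i * star W₀) * X) := by
    intro i
    by_cases hc : cen i
    · simp only [hH, hc, if_true]
    · simp only [hH, hc, if_false, star_mul, hX, mul_neg, mul_assoc]
  have hF₀1 : ‖F₀ - 1‖ ≤ α := by
    refine (pi_norm_le_iff_of_nonneg hα0).2 fun i => ?_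
    by_cases hc : cen i
    · simp only [Pi.sub_apply, Pi.one_apply, hF₀, hc, if_true, sub_self, norm_zero]; exact hα0
    · simp only [Pi.sub_apply, Pi.one_apply, hF₀, hc, if_false]; exact hh i hc
  have hF₀i : ∀ i, ‖F₀ i - 1‖ ≤ α := fun i => (norm_le_pi_norm (F₀ - 1) i).trans hF₀1
  have hhW : ∀ i, ¬ cen i → ‖h i * star W₀‖ ≤ 1 + α := fun i hc => by
    have e : h i * star W₀ = (h i * star W₀ - 1) + 1 := by abel
    rw [e]
    exact (norm_add_le _ _).trans (by rw [norm_one]; linarith [hh i hc])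
  have hHn : ‖H‖ ≤ (1 + α) * ‖X‖ := by
    refine (pi_norm_le_iff_of_nonneg (by positivity)).2 fun i => ?_
    rw [hHi]
    by_cases hc : cen i
    · simp only [hc, if_true, norm_zero]; positivity
    · simp only [hc, if_false, norm_neg]
      exact (norm_mul_le _ _).trans (mul_le_mul_of_nonneg_right (hhW i hc) (norm_nonneg _))
  -- (0.8): `D eml(F₀) = mean + O(α)`, `eml(F₀) = 1 + O(α)`
  have hE₁ : ‖D - meanCLM ι (Matrix (Fin N) (Fin N) ℂ) H‖ ≤ 150 * α * ‖X‖ := by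
    have h1 := norm_fderiv_eml_sub_mean_le (U := F₀) (hF₀1.trans hα) H
    calc _ ≤ 144 * ‖H‖ * ‖F₀ - 1‖ := h1
      _ ≤ 144 * ((1 + α) * ‖X‖) * α := by gcongr
      _ ≤ 150 * α * ‖X‖ := by nlinarith [norm_nonneg X, mul_nonneg hα0 (norm_nonneg X)]
  have hE₂ : ‖eml F₀ - 1‖ ≤ 6 * α := norm_eml_sub_one_le_six_mul hF₀i (hα.trans (by norm_num))
  -- the mean of `H` against `(1 − m∕|I|)·X`
  have hsumH : ∑ i, H i + (m : ℂ) • X = ∑ i, (if cen i then (0 : Matrix (Fin N) (Fin N) ℂ) else -((h i * star W₀ - 1) * X)) := by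
    have hmX : (m : ℂ) • X = ∑ i, (if cen i then (0 : Matrix (Fin N) (Fin N) ℂ) else X) := by
      rw [Finset.sum_ite, Finset.sum_const_zero, zero_add, Finset.sum_const, hm, ← Nat.cast_smul_eq_nsmul ℂ]
    rw [hmX, ← Finset.sum_add_distrib]
    refine Finset.sum_congr rfl fun i _ => ?_
    rw [hHi]
    by_cases hc : cen i
    · simp only [hc, if_true, add_zero]
    · simp only [hc, if_false]; noncomm_ring
  have hR : ‖meanCLM ι (Matrix (Fin N) (Fin N) ℂ) H + ((m : ℂ) / cI) • X‖ ≤ α * ‖X‖ := by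
    have e : meanCLM ι (Matrix (Fin N) (Fin N) ℂ) H + ((m : ℂ) / cI) • X = cI⁻¹ • (∑ i, H i + (m : ℂ) • X) := by
      rw [meanCLM_apply, smul_add, smul_smul, div_eq_inv_mul]
    rw [e, hsumH, norm_smul, norm_inv, hcI, Complex.norm_natCast]
    have hterm : ∀ i, ‖(if cen i then (0 : Matrix (Fin N) (Fin N) ℂ) else -((h i * star W₀ - 1) * X))‖ ≤ α * ‖X‖ := fun i => by
      by_cases hc : cen i
      · simp only [hc, if_true, norm_zero]; positivity
      · simp only [hc, if_false, norm_neg]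
        exact (norm_mul_le _ _).trans (mul_le_mul_of_nonneg_right (hh i hc) (norm_nonneg _))
    have hs := (norm_sum_le _ _).trans (Finset.sum_le_sum fun i (_ : i ∈ Finset.univ) => hterm i)
    rw [Finset.sum_const, Finset.card_univ, nsmul_eq_mul] at hs
    have hc0 : (0 : ℝ) < Fintype.card ι := by exact_mod_cast hcard
    calc (Fintype.card ι : ℝ)⁻¹ * ‖∑ i, (if cen i then (0 : Matrix (Fin N) (Fin N) ℂ) else -((h i * star W₀ - 1) * X))‖
        ≤ (Fintype.card ι : ℝ)⁻¹ * ((Fintype.card ι : ℝ) * (α * ‖X‖)) := by gcongr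
      _ = α * ‖X‖ := by field_simp
  -- assemble
  have hWW : X * W₀ * star W₀ = X := by rw [mul_assoc, hW₀, mul_one]
  have e : (D * W₀ + eml F₀ * (X * W₀)) * star W₀ - X + ((m : ℂ) / cI) • X =
      (D - meanCLM ι (Matrix (Fin N) (Fin N) ℂ) H) + (meanCLM ι (Matrix (Fin N) (Fin N) ℂ) H + ((m : ℂ) / cI) • X) + (eml F₀ - 1) * X := by
    rw [add_mul, mul_assoc D, hW₀, mul_one, mul_assoc (eml F₀), hWW]
    noncomm_ring
  rw [e]
  calc _ ≤ ‖D - meanCLM ι (Matrix (Fin N) (Fin N) ℂ) H‖ + ‖meanCLM ι (Matrix (Fin N) (Fin N) ℂ) H + ((m : ℂ) / cI) • X‖ + ‖(eml F₀ - 1) * X‖ :=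
        (norm_add_le _ _).trans (add_le_add (norm_add_le _ _) le_rfl)
    _ ≤ 150 * α * ‖X‖ + α * ‖X‖ + 6 * α * ‖X‖ :=
        add_le_add (add_le_add hE₁ hR) ((norm_mul_le _ _).trans (mul_le_mul_of_nonneg_right hE₂ (norm_nonneg _)))
    _ = 157 * α * ‖X‖ := by ring

end NormalForm

/-! ## §2  The (0.4) average in its private coordinate: the normal form in matrices for `SU(N)`, and file 3's `fderiv` response identified with `DΦ` -/

section Private

variable {P : Params} {j : ℕ} {N : ℕ} [NeZero N]

omit [NeZero N] in
/-- The chart direction `t·Y δ_β` is the update of the single bond `β`: `U·exp(t·Yδ_β) = U[β ↦ U(β)·exp(tY)]`. [cite: Balaban1985RegularSpaces, (1.10) p.77 (bookkeeping)] -/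
theorem expChart_smul_single (U : GaugeField P j (SU N)) (β : PBond P j) (Y : lieSU (Fin N)) (t : ℝ) :
    expChart U (t • (Pi.single β Y : PBond P j → lieSU (Fin N))) = Function.update U β (U β * expSU (t • Y)) := by
  funext b
  by_cases hb : b = β
  · subst hb
    rw [Function.update_self]
    show U b * expSU ((t • (Pi.single b Y : PBond P j → lieSU (Fin N))) b) = U b * expSU (t • Y)
    rw [Pi.smul_apply, Pi.single_eq_same]
  · rw [Function.update_of_ne hb]
    show U b * expSU ((t • (Pi.single β Y : PBond P j → lieSU (Fin N))) b) = U b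
    rw [Pi.smul_apply, Pi.single_eq_of_ne hb, smul_zero]
    have h1 : expSU (0 : lieSU (Fin N)) = 1 := Subtype.ext (by rw [coe_expSU]; simp)
    rw [h1, mul_one]

/-- **THE ONE-VARIABLE NORMAL FORM OF (0.4) IN MATRICES, `SU(N)`** (the `SU(2)` edition is the route `UnitScaleTilt`'s `Prop8Criticality.coe_avgFun_update_centralBond`): for `U′ = U[β(c) ↦ g]` with the
loop variables AT `c` inside the guard, `↑Ū′(c) = eml(i ↦ central ? 1 : ↑h_i·(↑pre·↑g·↑post)*)·(↑pre·↑g·↑post)`, `h_i` the open holonomies of `U` (central loops are degenerate). [cite: Balaban1987RG1, (0.4) p.253] -/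
theorem coe_avgFun_update_centralBond_SUN (hj : j + 1 ≤ P.m + P.K) (U : GaugeField P j (SU N)) (c : PBond P (j + 1)) (g : SU N)
    (hsmall : Small (expMeanLogSU (n := Fin N)) (Function.update U (centralBond c) g) c) :
    ((avgFun (expMeanLogSU (n := Fin N)) (Function.update U (centralBond c) g) c : SU N) : Matrix (Fin N) (Fin N) ℂ) =
      eml (fun i : Idx P => if IsCentral c i then (1 : Matrix (Fin N) (Fin N) ℂ) else
          ((openHol U c i : SU N) : Matrix (Fin N) (Fin N) ℂ) *
            star (((pre U c : SU N) : Matrix (Fin N) (Fin N) ℂ) * (g : Matrix (Fin N) (Fin N) ℂ) * ((post U c : SU N) : Matrix (Fin N) (Fin N) ℂ))) *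
        (((pre U c : SU N) : Matrix (Fin N) (Fin N) ℂ) * (g : Matrix (Fin N) (Fin N) ℂ) * ((post U c : SU N) : Matrix (Fin N) (Fin N) ℂ)) := by
  haveI : Nonempty (Fin N) := ⟨⟨0, Nat.pos_of_ne_zero (NeZero.ne N)⟩⟩
  have hW : BlockAveragingEMLHaarAC.FibreSmall (expMeanLogSU (n := Fin N)) U c (pre U c * g * post U c) :=
    (small_update_centralBond_self_iff hj _ U c g).1 hsmall
  have hW' : ∀ i, dist1 (fibreFamily U c (pre U c * g * post U c) i) < (expMeanLogSU (n := Fin N)).δ := hW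
  rw [avgFun_update_centralBond_self hj, fibreMap_of_mem _ U c hW, Submonoid.coe_mul, coe_avg_expMeanLogSU _ hW', ← eml_eq_exp,
    Submonoid.coe_mul, Submonoid.coe_mul]
  congr 2
  funext i
  by_cases hc : IsCentral c i
  · rw [if_pos hc, fibreFamily_of_isCentral U c _ i hc]; rfl
  · rw [if_neg hc, coe_fibreFamily_of_not_isCentral U c _ i hc, Submonoid.coe_mul, Submonoid.coe_mul]

/-- At `g = U(β)` the off-central normal-form family is the family of loop variables of `U` at `c`. [cite: Balaban1987RG1, (0.4) p.253 (bookkeeping)] -/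
theorem normalForm_family_self (hj : j + 1 ≤ P.m + P.K) (U : GaugeField P j (SU N)) (c : PBond P (j + 1)) (i : Idx P) (hc : ¬ IsCentral c i) :
    ((openHol U c i : SU N) : Matrix (Fin N) (Fin N) ℂ) *
        star (((pre U c : SU N) : Matrix (Fin N) (Fin N) ℂ) * ((U (centralBond c) : SU N) : Matrix (Fin N) (Fin N) ℂ) * ((post U c : SU N) : Matrix (Fin N) (Fin N) ℂ)) =
      ((loopHol U c i : SU N) : Matrix (Fin N) (Fin N) ℂ) := by
  have h := BlockAveragingEMLHaarAC.loopHol_update_centralBond_self hj U c (U (centralBond c))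
  rw [Function.update_eq_self] at h
  rw [h, coe_fibreFamily_of_not_isCentral U c _ i hc, Submonoid.coe_mul, Submonoid.coe_mul]

omit [NeZero N] in
/-- The bond velocities of the single-bond chart curve `t ↦ U·exp(t·Yδ_β)`: `U(β)·Y` at `β`, `0` elsewhere. [cite: Balaban1985RegularSpaces, (1.10) p.77 (bookkeeping)] -/
theorem hasDerivAt_coe_expChart_single (U : GaugeField P j (SU N)) (β : PBond P j) (Y : lieSU (Fin N)) (b : PBond P j) :
    HasDerivAt (fun t : ℝ => ((expChart U (t • (Pi.single β Y : PBond P j → lieSU (Fin N))) b : SU N) : Matrix (Fin N) (Fin N) ℂ))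
      ((Pi.single β (((U β : SU N) : Matrix (Fin N) (Fin N) ℂ) * (Y : Matrix (Fin N) (Fin N) ℂ)) : PBond P j → Matrix (Fin N) (Fin N) ℂ) b) 0 := by
  have h := hasDerivAt_coe_expChart_along (U := U) (c := fun t : ℝ => t • (Pi.single β Y : PBond P j → lieSU (Fin N))) (hasDerivAt_ray _) (zero_smul ℝ _) b
  by_cases hb : b = β
  · subst hb; rw [Pi.single_eq_same]; rw [Pi.single_eq_same] at h; exact h
  · rw [Pi.single_eq_of_ne hb]; rw [Pi.single_eq_of_ne hb, ZeroMemClass.coe_zero, mul_zero] at h; exact h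

/-- ★ **THE RESPONSE AS A VELOCITY**: `D(W ↦ avgM W c)(↑U)[U(β)·Y·δ_β]` is the velocity at `0` of `t ↦ ↑Ū(U·exp(t·Yδ_{β(c)}))(c)` (file 3's one-bond velocity brick at the single-bond curve).
[cite: Balaban1987RG1, (0.4) p.253; Balaban1985Variational, (44) p.285] -/
theorem hasDerivAt_coe_avgFun_expChart_single (hj : j + 1 ≤ P.m + P.K) (U : GaugeField P j (SU N)) (c : PBond P (j + 1))
    (hsmall : Small (expMeanLogSU (n := Fin N)) U c) (Y : lieSU (Fin N)) :
    HasDerivAt (fun t : ℝ => ((avgFun (expMeanLogSU (n := Fin N)) (expChart U (t • (Pi.single (centralBond c) Y : PBond P j → lieSU (Fin N)))) c : SU N) :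
        Matrix (Fin N) (Fin N) ℂ))
      (fderiv ℝ (fun W : PBond P j → Matrix (Fin N) (Fin N) ℂ => avgM W c) (coeField U)
        (Pi.single (centralBond c) (((U (centralBond c) : SU N) : Matrix (Fin N) (Fin N) ℂ) * (Y : Matrix (Fin N) (Fin N) ℂ)))) 0 := by
  have h0 : expChart U ((0 : ℝ) • (Pi.single (centralBond c) Y : PBond P j → lieSU (Fin N))) = U := by rw [zero_smul, expChart_zero]
  have hL := N07CentralDescendantLifts.hasDerivAt_coe_avgFun_comp_apply_of_small_of_local hj
    (Φ := fun t : ℝ => expChart U (t • (Pi.single (centralBond c) Y : PBond P j → lieSU (Fin N)))) c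
    (by rw [h0]; exact hsmall) (fun b _ => hasDerivAt_coe_expChart_single U (centralBond c) Y b)
  rw [h0] at hL
  exact hL

/-- ★★ **FILE 3's RESPONSE IS THE DERIVATIVE OF THE NORMAL FORM**: for `Y ∈ 𝔰𝔲(N)`, with `W₀ = ↑pre·↑U(β)·↑post` and `V = ↑pre·(↑U(β)·↑Y)·↑post`,
`D(W ↦ avgM W c)(↑U)[U(β)·Y·δ_β] = D eml(F₀)[i ↦ central ? 0 : ↑h_i·V*]·W₀ + eml(F₀)·V` (both are the velocity at `0` of `t ↦ ↑Ū(U·exp(tYδ_β))(c)`: the left by file 3's brick, the right by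
§1 through the normal form, which holds along the curve near `t = 0`). [cite: Balaban1987RG1, (0.4) p.253; Balaban1985Variational, (44) p.285] -/
theorem fderiv_avgM_single_centralBond_eq_normalForm (hj : j + 1 ≤ P.m + P.K) (U : GaugeField P j (SU N)) (c : PBond P (j + 1))
    (hsmall : Small (expMeanLogSU (n := Fin N)) U c) (Y : lieSU (Fin N)) :
    fderiv ℝ (fun W : PBond P j → Matrix (Fin N) (Fin N) ℂ => avgM W c) (coeField U)
        (Pi.single (centralBond c) (((U (centralBond c) : SU N) : Matrix (Fin N) (Fin N) ℂ) * (Y : Matrix (Fin N) (Fin N) ℂ))) =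
      fderiv ℂ (eml : (Idx P → Matrix (Fin N) (Fin N) ℂ) → Matrix (Fin N) (Fin N) ℂ)
          (fun i => if IsCentral c i then 1 else ((openHol U c i : SU N) : Matrix (Fin N) (Fin N) ℂ) *
            star (((pre U c : SU N) : Matrix (Fin N) (Fin N) ℂ) * ((U (centralBond c) : SU N) : Matrix (Fin N) (Fin N) ℂ) * ((post U c : SU N) : Matrix (Fin N) (Fin N) ℂ)))
          (fun i => if IsCentral c i then 0 else ((openHol U c i : SU N) : Matrix (Fin N) (Fin N) ℂ) *
            star (((pre U c : SU N) : Matrix (Fin N) (Fin N) ℂ) * (((U (centralBond c) : SU N) : Matrix (Fin N) (Fin N) ℂ) * (Y : Matrix (Fin N) (Fin N) ℂ)) *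
              ((post U c : SU N) : Matrix (Fin N) (Fin N) ℂ))) *
          (((pre U c : SU N) : Matrix (Fin N) (Fin N) ℂ) * ((U (centralBond c) : SU N) : Matrix (Fin N) (Fin N) ℂ) * ((post U c : SU N) : Matrix (Fin N) (Fin N) ℂ)) +
        eml (fun i => if IsCentral c i then (1 : Matrix (Fin N) (Fin N) ℂ) else ((openHol U c i : SU N) : Matrix (Fin N) (Fin N) ℂ) *
            star (((pre U c : SU N) : Matrix (Fin N) (Fin N) ℂ) * ((U (centralBond c) : SU N) : Matrix (Fin N) (Fin N) ℂ) * ((post U c : SU N) : Matrix (Fin N) (Fin N) ℂ))) *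
          (((pre U c : SU N) : Matrix (Fin N) (Fin N) ℂ) * (((U (centralBond c) : SU N) : Matrix (Fin N) (Fin N) ℂ) * (Y : Matrix (Fin N) (Fin N) ℂ)) *
            ((post U c : SU N) : Matrix (Fin N) (Fin N) ℂ)) := by
  set X : PBond P j → lieSU (Fin N) := Pi.single (centralBond c) Y with hXdef
  have hvel : ∀ b : PBond P j, HasDerivAt (fun t : ℝ => ((expChart U (t • X) b : SU N) : Matrix (Fin N) (Fin N) ℂ))
      ((Pi.single (centralBond c) (((U (centralBond c) : SU N) : Matrix (Fin N) (Fin N) ℂ) * (Y : Matrix (Fin N) (Fin N) ℂ)) :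
        PBond P j → Matrix (Fin N) (Fin N) ℂ) b) 0 := fun b => hasDerivAt_coe_expChart_single U (centralBond c) Y b
  have h0 : expChart U ((0 : ℝ) • X) = U := by rw [zero_smul, expChart_zero]
  -- LEFT: file 3's velocity brick
  have hL := hasDerivAt_coe_avgFun_expChart_single hj U c hsmall Y
  -- RIGHT: §1 along the private-coordinate curve `W(t) = ↑pre·↑(U·exp(tX))(β)·↑post`
  have hWcurve : HasDerivAt (fun t : ℝ => ((pre U c : SU N) : Matrix (Fin N) (Fin N) ℂ) * ((expChart U (t • X) (centralBond c) : SU N) : Matrix (Fin N) (Fin N) ℂ) *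
        ((post U c : SU N) : Matrix (Fin N) (Fin N) ℂ))
      (((pre U c : SU N) : Matrix (Fin N) (Fin N) ℂ) * (((U (centralBond c) : SU N) : Matrix (Fin N) (Fin N) ℂ) * (Y : Matrix (Fin N) (Fin N) ℂ)) *
        ((post U c : SU N) : Matrix (Fin N) (Fin N) ℂ)) 0 := by
    have h := hvel (centralBond c)
    rw [Pi.single_eq_same] at h
    exact (h.const_mul _).mul_const _
  have hpoly : ∀ i : Idx P, ‖(if IsCentral c i then (1 : Matrix (Fin N) (Fin N) ℂ) else ((openHol U c i : SU N) : Matrix (Fin N) (Fin N) ℂ) *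
      star ((fun t : ℝ => ((pre U c : SU N) : Matrix (Fin N) (Fin N) ℂ) * ((expChart U (t • X) (centralBond c) : SU N) : Matrix (Fin N) (Fin N) ℂ) *
        ((post U c : SU N) : Matrix (Fin N) (Fin N) ℂ)) 0)) - 1‖ < 1 := by
    intro i
    simp only [h0]
    by_cases hc : IsCentral c i
    · rw [if_pos hc, sub_self, norm_zero]; exact one_pos
    · rw [if_neg hc, normalForm_family_self hj U c i hc, coe_loopHol]
      exact norm_loopM_coeField_sub_one_lt_one U c hsmall i
  have hR := hasDerivAt_eml_normalForm (IsCentral c) (fun i => ((openHol U c i : SU N) : Matrix (Fin N) (Fin N) ℂ)) hWcurve hpoly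
  simp only [h0] at hR
  -- the normal form holds along the curve near `0`
  have hguard : ∀ᶠ t in 𝓝 (0 : ℝ), Small (expMeanLogSU (n := Fin N)) (expChart U (t • X)) c :=
    N07AveragingLocalSmooth.eventually_small_comp_of_small_of_local hj (Φ := fun t : ℝ => expChart U (t • X)) c (by rw [h0]; exact hsmall)
      fun b _ => (hvel b).continuousAt
  have heq : (fun t : ℝ => ((avgFun (expMeanLogSU (n := Fin N)) (expChart U (t • X)) c : SU N) : Matrix (Fin N) (Fin N) ℂ)) =ᶠ[𝓝 (0 : ℝ)]
      fun t => eml (fun i => if IsCentral c i then (1 : Matrix (Fin N) (Fin N) ℂ) else ((openHol U c i : SU N) : Matrix (Fin N) (Fin N) ℂ) *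
          star (((pre U c : SU N) : Matrix (Fin N) (Fin N) ℂ) * ((expChart U (t • X) (centralBond c) : SU N) : Matrix (Fin N) (Fin N) ℂ) *
            ((post U c : SU N) : Matrix (Fin N) (Fin N) ℂ))) *
        (((pre U c : SU N) : Matrix (Fin N) (Fin N) ℂ) * ((expChart U (t • X) (centralBond c) : SU N) : Matrix (Fin N) (Fin N) ℂ) *
          ((post U c : SU N) : Matrix (Fin N) (Fin N) ℂ)) :=
    hguard.mono fun t ht => by
      have hupd : expChart U (t • X) = Function.update U (centralBond c) (U (centralBond c) * expSU (t • Y)) := expChart_smul_single U _ Y t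
      have ht' : Small (expMeanLogSU (n := Fin N)) (Function.update U (centralBond c) (U (centralBond c) * expSU (t • Y))) c := by rw [← hupd]; exact ht
      dsimp only
      rw [hupd, coe_avgFun_update_centralBond_SUN hj U c _ ht', Function.update_self]
  exact hL.unique (hR.congr_of_eventuallyEq heq)

end Private

end Summit.QuantumFields.YangMills.BalabanUVNodes.N07CentralResponseNormalForm

end
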